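import Mathlib
import HarnessLib

/-!
# Root location of the generic Euler-species factor (stub `stub_localRootBound`, E3)

Line `euler-species-factorisation` of crux stmt-Parity-11291
(`Summit.Parity.BatemanHorn.Theses.AlmostPrimeZeros.SystemZeroRepulsion`), stub E3 — pure polynomial algebra
over `ℂ`, no number theory.

Let `E = Σ_{n < p²} X^{e(n)} ∈ ℂ[X]` with `e(n) ≤ 2` on `range (p²)`, `#{n < p² : e(n) ≠ 0} ≤ D·p`,
`#{n < p² : e(n) = 2} ≤ D`, `1 ≤ D`, `8D ≤ p`.  Then every root `ρ` of `E` has `‖ρ‖ > p/(4D)` (otherwise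
`#{e = 0} = |Σ_{e(n)≠0} ρ^{e(n)}| ≤ Dp‖ρ‖ + D‖ρ‖² ≤ 5p²/16 < 7p²/8 ≤ p² − Dp ≤ #{e = 0}`), hence
`‖1 − ρ‖ > p/(8D)` and, `E` having degree `≤ 2` (and `E ≠ 0`: `E(1) = p²`), the zero functional satisfies
`T(E) = Σ_ρ ‖1−ρ‖⁻² ≤ 2 · 64D²/p² = 128 D²/p²`.
-/

namespace Summit.Parity.BatemanHorn.Cruxes.SystemZeroRepulsion.EulerSpeciesFactorisation

open Polynomial Finset

/-- **E3 (root bound for the generic quadratic Euler factor).** If `e ≤ 2` on `range (p²)`,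
`#{n < p² : e n ≠ 0} ≤ D p`, `#{n < p² : e n = 2} ≤ D`, `1 ≤ D` and `8 D ≤ p`, then
`Σ_{ρ ∈ roots (Σ_{n<p²} X^{e n})} ‖1−ρ‖⁻² ≤ 128 D²/p²` (every root has `‖ρ‖ > p/(4D) ≥ 2`, so
`‖1−ρ‖ ≥ ‖ρ‖ − 1 > p/(8D)`; at most `2` roots since the degree is `≤ 2` and the polynomial is non-zero). -/
theorem stub_localRootBound :
    ∀ (p D : ℕ) (e : ℕ → ℕ), 1 ≤ D → 8 * D ≤ p →
      (∀ n ∈ Finset.range (p ^ 2), e n ≤ 2) →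
      ((Finset.range (p ^ 2)).filter (fun n : ℕ => e n ≠ 0)).card ≤ D * p →
      ((Finset.range (p ^ 2)).filter (fun n : ℕ => e n = 2)).card ≤ D →
      ((∑ n ∈ Finset.range (p ^ 2), (Polynomial.X : Polynomial ℂ) ^ (e n)).roots.map
          (fun ρ : ℂ => (‖(1 : ℂ) - ρ‖ ^ 2)⁻¹)).sum ≤ 128 * (D : ℝ) ^ 2 / (p : ℝ) ^ 2 := by
  intro p D e hD hp he h1 h2
  -- real-number versions of the numeric hypotheses
  have hp0 : (0 : ℝ) < p := Nat.cast_pos.mpr (by omega)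
  have hDr : (1 : ℝ) ≤ D := by exact_mod_cast hD
  have hpr : 8 * (D : ℝ) ≤ p := by exact_mod_cast hp
  have h1r : (((Finset.range (p ^ 2)).filter (fun n : ℕ => e n ≠ 0)).card : ℝ) ≤ D * p := by
    exact_mod_cast h1
  have h2r : (((Finset.range (p ^ 2)).filter (fun n : ℕ => e n = 2)).card : ℝ) ≤ D := by
    exact_mod_cast h2
  set B : ℝ := 64 * (D : ℝ) ^ 2 / (p : ℝ) ^ 2 with hB
  have hB0 : 0 ≤ B := by positivity
  set E : Polynomial ℂ := ∑ n ∈ Finset.range (p ^ 2), (Polynomial.X : Polynomial ℂ) ^ (e n) with hE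
  -- the degree is at most `2`, hence at most `2` roots (with multiplicity)
  have hdeg : E.natDegree ≤ 2 := by
    refine Polynomial.natDegree_sum_le_of_forall_le _ _ (fun n hn => ?_)
    rw [Polynomial.natDegree_X_pow]
    exact he n hn
  have hcard : Multiset.card E.roots ≤ 2 := (Polynomial.card_roots' E).trans hdeg
  -- every root `ρ` satisfies `(‖1 - ρ‖ ^ 2)⁻¹ ≤ B`
  have hroot : ∀ ρ ∈ E.roots, (‖(1 : ℂ) - ρ‖ ^ 2)⁻¹ ≤ B := by
    intro ρ hρ
    have hev : ∑ n ∈ Finset.range (p ^ 2), ρ ^ (e n) = 0 := by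
      have h := (Polynomial.mem_roots'.1 hρ).2
      rw [Polynomial.IsRoot.def, hE, Polynomial.eval_finsetSum] at h
      simpa only [Polynomial.eval_pow, Polynomial.eval_X] using h
    -- `p² = Σ (1 - ρ^{e n})`
    have hid : ((p : ℂ)) ^ 2 = ∑ n ∈ Finset.range (p ^ 2), ((1 : ℂ) - ρ ^ (e n)) := by
      rw [Finset.sum_sub_distrib, hev, sub_zero]
      simp
    -- termwise bound
    have hterm : ∀ n ∈ Finset.range (p ^ 2), ‖(1 : ℂ) - ρ ^ (e n)‖ ≤
        (if e n ≠ 0 then 1 + ‖ρ‖ else 0) + (if e n = 2 then ‖ρ‖ ^ 2 else 0) := by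
      intro n hn
      have hle := he n hn
      generalize e n = k at hle ⊢
      interval_cases k
      · simp
      · norm_num
        calc ‖(1 : ℂ) - ρ‖ ≤ ‖(1 : ℂ)‖ + ‖ρ‖ := norm_sub_le _ _
          _ = 1 + ‖ρ‖ := by rw [norm_one]
      · norm_num
        calc ‖(1 : ℂ) - ρ ^ 2‖ ≤ ‖(1 : ℂ)‖ + ‖ρ ^ 2‖ := norm_sub_le _ _
          _ = 1 + ‖ρ‖ ^ 2 := by rw [norm_one, norm_pow]
          _ ≤ 1 + ‖ρ‖ + ‖ρ‖ ^ 2 := by linarith [norm_nonneg ρ]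
    -- the counting inequality `p² ≤ #{e ≠ 0} (1 + ‖ρ‖) + #{e = 2} ‖ρ‖²`
    have key : ((p : ℝ)) ^ 2 ≤
        (((Finset.range (p ^ 2)).filter (fun n : ℕ => e n ≠ 0)).card : ℝ) * (1 + ‖ρ‖) +
        (((Finset.range (p ^ 2)).filter (fun n : ℕ => e n = 2)).card : ℝ) * ‖ρ‖ ^ 2 := by
      calc ((p : ℝ)) ^ 2 = ‖((p : ℂ)) ^ 2‖ := by rw [norm_pow, Complex.norm_natCast]
        _ = ‖∑ n ∈ Finset.range (p ^ 2), ((1 : ℂ) - ρ ^ (e n))‖ := by rw [hid]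
        _ ≤ ∑ n ∈ Finset.range (p ^ 2), ‖(1 : ℂ) - ρ ^ (e n)‖ := norm_sum_le _ _
        _ ≤ ∑ n ∈ Finset.range (p ^ 2),
              ((if e n ≠ 0 then 1 + ‖ρ‖ else 0) + (if e n = 2 then ‖ρ‖ ^ 2 else 0)) :=
            Finset.sum_le_sum hterm
        _ = _ := by
            rw [Finset.sum_add_distrib, ← Finset.sum_filter, ← Finset.sum_filter, Finset.sum_const,
              Finset.sum_const, nsmul_eq_mul, nsmul_eq_mul]
    -- hence `‖ρ‖ > p / (4 D)`
    have ha : (p : ℝ) < 4 * D * ‖ρ‖ := by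
      by_contra hcon
      rw [not_lt] at hcon
      nlinarith [mul_le_mul_of_nonneg_right h1r (by positivity : (0 : ℝ) ≤ 1 + ‖ρ‖),
        mul_le_mul_of_nonneg_right h2r (sq_nonneg ‖ρ‖),
        mul_le_mul_of_nonneg_right hpr hp0.le,
        mul_le_mul_of_nonneg_right hcon hp0.le,
        pow_le_pow_left₀ (by positivity : (0 : ℝ) ≤ 4 * D * ‖ρ‖) hcon 2,
        mul_le_mul_of_nonneg_right hDr (by positivity : (0 : ℝ) ≤ D * ‖ρ‖ ^ 2),
        mul_pos hp0 hp0]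
    -- hence `‖1 - ρ‖ > p / (8 D)`
    have h3 : ‖ρ‖ - 1 ≤ ‖(1 : ℂ) - ρ‖ := by
      have h := norm_sub_norm_le ρ (1 : ℂ)
      rwa [norm_one, norm_sub_rev] at h
    have hb : (p : ℝ) < 8 * D * ‖(1 : ℂ) - ρ‖ := by
      nlinarith [mul_le_mul_of_nonneg_left h3 (by positivity : (0 : ℝ) ≤ D)]
    have hpos : 0 < ‖(1 : ℂ) - ρ‖ := by
      rcases (norm_nonneg ((1 : ℂ) - ρ)).eq_or_lt with h0 | h0
      · rw [← h0, mul_zero] at hb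
        linarith
      · exact h0
    have hsq : (p : ℝ) ^ 2 ≤ (8 * D * ‖(1 : ℂ) - ρ‖) ^ 2 := pow_le_pow_left₀ hp0.le hb.le 2
    rw [hB, inv_eq_one_div, div_le_div_iff₀ (by positivity) (by positivity), one_mul]
    calc (p : ℝ) ^ 2 ≤ (8 * D * ‖(1 : ℂ) - ρ‖) ^ 2 := hsq
      _ = 64 * (D : ℝ) ^ 2 * ‖(1 : ℂ) - ρ‖ ^ 2 := by ring
  -- sum over the (at most two) roots
  have hsum := Multiset.sum_le_card_nsmul (E.roots.map (fun ρ : ℂ => (‖(1 : ℂ) - ρ‖ ^ 2)⁻¹)) B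
    (fun x hx => by
      obtain ⟨ρ, hρ, rfl⟩ := Multiset.mem_map.1 hx
      exact hroot ρ hρ)
  rw [Multiset.card_map, nsmul_eq_mul] at hsum
  have hc : (Multiset.card E.roots : ℝ) ≤ 2 := by exact_mod_cast hcard
  calc ((E.roots.map (fun ρ : ℂ => (‖(1 : ℂ) - ρ‖ ^ 2)⁻¹)).sum)
      ≤ (Multiset.card E.roots : ℝ) * B := hsum
    _ ≤ 2 * B := mul_le_mul_of_nonneg_right hc hB0
    _ = 128 * (D : ℝ) ^ 2 / (p : ℝ) ^ 2 := by rw [hB]; ring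

end Summit.Parity.BatemanHorn.Cruxes.SystemZeroRepulsion.EulerSpeciesFactorisation
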